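import Mathlib

/-!
# `MatrixDescartes` census — a kernel-evaluable CHECKER for engine-3's exact `V = 20` certificates (definitions)

HONEST FRAMING.  Object-search cell `pub-symmetroid`; door-A item `DoorA26 = PosRootLawAt 2 6 19`
(stmt-ValiantsHypothesis-19979; OPEN, typed, never asserted).  DEFINITIONS ONLY: a certificate language and a Boolean
checker (`V20.checkCell`, `V20.tableOK`, cover checks `V20.coverSlices` / `V20.planCovers`), written with structural
recursion over `List`/`ℕ`/`ℤ` so that the kernel evaluates it (`decide +kernel`).  Nothing is proved here: the semantics live in
`…CensusV20Model`, the soundness theorems in `…CensusV20Sound*`, and `…CensusV20Box24*` replay engine-3 g15's certificates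
(`box20.jsonl`, `box21-26.jsonl`; README-BOX20-e3g15.md) for every 2-Sidon support with `d₅ − d₀ ≤ 24`.
WHAT IS CHECKED.  A cell is a support `d = [d₀,…,d₅]` and an orientation `s` (`s = true`: lowest coefficient positive).  The 21
coefficients of `det (∑ X^(d l) • S l)` sit at the pair sums `d i + d j` (`i ≤ j`) and are the atoms `q i = det S i` / `β i j = 2·B(S i, S j)`;
`ord` lists the atoms by increasing pair sum (computed, then VERIFIED by `ordOK`); position `t` has sign `s·(−1)^t` for a hypothetical
twenty.  Rows are monomial inequalities `∏_{p∈L} x_p · Bden ≤ ∏_{p∈R} x_p · Bnum` in the absolute values `x_p` (Newton-cone rows C25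
with gap weights; single-positive-term and AM–GM rows of the Gram inequalities `G3, RCS ≥ 0`); a certificate is an odd definite
triangle (`sign`), a Farkas combination with natural multipliers (`lp`: exponent balance + comparison of the factored constants in `ℕ`
after cancelling common bases), or a single-monomial domination of a `G3`/`W` inequality (`dom`).  Row families as in engine-3 g15's
`boxcert.py` / `verify_box.py` (HOME/tools/engine3/g15), whose `V = 20` subset this file re-implements.  Nothing here bears on
`V = 19`, on `ζ_sym(2,6)` over all supports, on `MatrixDescartes` (stmt-ValiantsHypothesis-18050) or on `VP ≠ VNP`.

[folklore] Bookkeeping / certificate replay; elementary.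
-/

-- the D-0017 layout repeats a namespace component (single-conjunct summit); the `dupNamespace` linter flags it; name mandated.
set_option linter.dupNamespace false

namespace Summit.ValiantsHypothesis.ValiantsHypothesis.Theorems.LacunarySymmetroidMatrixDescartes.Census.V20

/-- An atom: an unordered pair of letters `(i, j)`, `i ≤ j < 6`, naming the coefficient `q i` (`i = j`) or `β i j`. [folklore] -/
abbrev Atom := ℕ × ℕ

/-- The 21 atoms. [folklore] -/
def allAtoms : List Atom := [(0,0), (0,1), (0,2), (0,3), (0,4), (0,5), (1,1), (1,2), (1,3), (1,4), (1,5),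
  (2,2), (2,3), (2,4), (2,5), (3,3), (3,4), (3,5), (4,4), (4,5), (5,5)]

/-- Pair sum of an atom on the support `d` (a list of six exponents). [folklore] -/
def psum (d : List ℕ) (a : Atom) : ℕ := d.getD a.1 0 + d.getD a.2 0

/-- Insertion by pair sum. [folklore] -/
def insBySum (d : List ℕ) (a : Atom) : List Atom → List Atom
  | [] => [a]
  | b :: l => if psum d a < psum d b then a :: b :: l else b :: insBySum d a l

/-- The atoms sorted by pair sum (its correctness is not proved but CHECKED by `ordOK`). [folklore] -/
def sortAtoms (d : List ℕ) : List Atom := allAtoms.foldr (insBySum d) []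

/-- Position of an atom in the order (`= length` if absent). [folklore] -/
def posOf (a : Atom) : List Atom → ℕ
  | [] => 0
  | b :: l => if b = a then 0 else posOf a l + 1

/-- The order is the list of all 21 atoms with strictly increasing pair sums (so the support is 2-Sidon). [folklore] -/
def ordOK (d : List ℕ) (ord : List Atom) : Bool :=
  decide (d.length = 6) && decide (ord.length = 21) && decide (∀ a ∈ allAtoms, a ∈ ord) &&
    decide (∀ b ∈ ord, b ∈ allAtoms) && decide (ord.Pairwise (fun a b => psum d a < psum d b))

/-- The sequence of the 21 pair sums in increasing order. [folklore] -/
def sums (d : List ℕ) (ord : List Atom) : List ℕ := ord.map (psum d)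

/-- Is the coefficient at position `t` NEGATIVE for a twenty of orientation `s` (sign `s·(−1)^t`)? [folklore] -/
def negAt (s : Bool) (t : ℕ) : Bool := if t % 2 = 0 then !s else s

/-! ## Polynomial inequalities in the coefficients: terms `γ · ∏ atoms` -/
/-- A term `(γ, atoms)` stands for `γ · ∏_{a ∈ atoms} (value of a)`; a polynomial is a list of terms. [folklore] -/
abbrev Term := ℤ × List Atom

/-- Diagonal atom `q i`. [folklore] -/
def qA (i : ℕ) : Atom := (i, i)

/-- Off-diagonal atom `β i j` (unordered). [folklore] -/
def cA (i j : ℕ) : Atom := if i ≤ j then (i, j) else (j, i)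

/-- `G3(i,j,k) = 4 qᵢqⱼqₖ + βᵢⱼβᵢₖβⱼₖ − qᵢβⱼₖ² − qⱼβᵢₖ² − qₖβᵢⱼ² ≥ 0` (half the `3 × 3` Gram determinant). [folklore] -/
def G3poly (i j k : ℕ) : List Term :=
  [(4, [qA i, qA j, qA k]), (1, [cA i j, cA i k, cA j k]), (-1, [qA i, cA j k, cA j k]),
   (-1, [qA j, cA i k, cA i k]), (-1, [qA k, cA i j, cA i j])]

/-- `RCS(i,j) = βᵢⱼ² − 4 qᵢqⱼ ≥ 0` when letter `i` is definite (reverse Cauchy–Schwarz). [folklore] -/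
def RCSpoly (i j : ℕ) : List Term := [(1, [cA i j, cA i j]), (-4, [qA i, qA j])]

/-- `W(i,j|k,l) ≥ 0`: `G3` of the derived letter `u = 2qⱼSᵢ − βᵢⱼSⱼ` with `Sₖ, Sₗ`, expanded (14 terms). [folklore] -/
def Wpoly (i j k l : ℕ) : List Term :=
  [(16, [qA i, qA j, qA j, qA k, qA l]), (-4, [qA i, qA j, qA j, cA k l, cA k l]),
   (-4, [qA j, qA k, qA l, cA i j, cA i j]), (1, [qA j, cA i j, cA i j, cA k l, cA k l]),
   (-4, [qA j, qA j, qA l, cA i k, cA i k]), (4, [qA j, qA l, cA i j, cA i k, cA j k]),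
   (-1, [qA l, cA i j, cA i j, cA j k, cA j k]),
   (4, [qA j, qA j, cA i k, cA i l, cA k l]), (-2, [qA j, cA i j, cA i k, cA j l, cA k l]),
   (-2, [qA j, cA i j, cA i l, cA j k, cA k l]), (1, [cA i j, cA i j, cA j k, cA j l, cA k l]),
   (-4, [qA j, qA j, qA k, cA i l, cA i l]), (4, [qA j, qA k, cA i j, cA i l, cA j l]),
   (-1, [qA k, cA i j, cA i j, cA j l, cA j l])]

/-- The inequality families a certificate may name. [folklore] -/
inductive PolySpec where
  /-- `G3(i,j,k) ≥ 0`, `i < j < k` -/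
  | g3 (i j k : ℕ)
  /-- `RCS(i,j) ≥ 0`, letter `i` definite -/
  | rcs (i j : ℕ)
  /-- `W(i,j|k,l) ≥ 0`, four distinct letters, `k < l` -/
  | w (i j k l : ℕ)

/-- Index validity of a named inequality (definiteness of `RCS`'s first letter is checked separately). [folklore] -/
def PolySpec.valid : PolySpec → Bool
  | .g3 i j k => decide (i < j ∧ j < k ∧ k < 6)
  | .rcs i j => decide (i < 6 ∧ j < 6 ∧ i ≠ j)
  | .w i j k l => decide (i < 6 ∧ j < 6 ∧ k < 6 ∧ l < 6 ∧ i ≠ j ∧ i ≠ k ∧ i ≠ l ∧ j ≠ k ∧ j ≠ l ∧ k < l)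

/-- The term list of a named inequality. [folklore] -/
def PolySpec.poly : PolySpec → List Term
  | .g3 i j k => G3poly i j k
  | .rcs i j => RCSpoly i j
  | .w i j k l => Wpoly i j k l

/-- Positions (with multiplicity) of a term's atoms. [folklore] -/
def posl (ord : List Atom) (A : List Atom) : List ℕ := A.map (fun a => posOf a ord)

/-- Parity of the number of `true`s. [folklore] -/
def oddTrues : List Bool → Bool
  | [] => false
  | b :: l => xor b (oddTrues l)

/-- Is the term NEGATIVE under the sign pattern of orientation `s`? [folklore] -/
def termNeg (ord : List Atom) (s : Bool) (T : Term) : Bool :=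
  xor (decide (T.1 < 0)) (oddTrues (T.2.map fun a => negAt s (posOf a ord)))

/-! ## Rows: `∏_{p ∈ L} x_p · val Bden ≤ ∏_{p ∈ R} x_p · val Bnum` -/
/-- A natural number in factored form `∏ b^e`, as a list of `(b, e)`. [folklore] -/
abbrev FNat := List (ℕ × ℕ)

/-- Value of a factored natural. [folklore] -/
def fval (F : FNat) : ℕ := (F.map fun be => be.1 ^ be.2).prod

/-- A row (see the module docstring). [folklore] -/
structure Row where
  /-- positions on the small side, with multiplicity -/
  L : List ℕ
  /-- positions on the large side, with multiplicity -/
  R : List ℕ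
  /-- constant on the large side -/
  Bnum : FNat
  /-- constant on the small side -/
  Bden : FNat

/-- `|a − b|`, but `1` when `a = b` (so that a product over ALL sums equals the product over the OTHER sums). [folklore] -/
def dist1 (a b : ℕ) : ℕ := if a = b then 1 else if a ≤ b then b - a else a - b

/-- The Newton-cone row C25 through positions `t−1, t, t+1` (`1 ≤ t ≤ 19`):
`x_{t−1}^{Δ₂} x_{t+1}^{Δ₁} · W_{t−1}^{Δ₂} W_{t+1}^{Δ₁} ≤ x_t^{Δ} · W_t^{Δ}`, `W_e = ∏_{u ≠ e} |e − u|`. [folklore] -/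
def rowC25 (E : List ℕ) (t : ℕ) : Row :=
  let p := E.getD (t - 1) 0
  let q := E.getD t 0
  let r := E.getD (t + 1) 0
  let D1 := q - p
  let D2 := r - q
  { L := List.replicate D2 (t - 1) ++ List.replicate D1 (t + 1)
    R := List.replicate (D1 + D2) t
    Bnum := E.map fun u => (dist1 q u, D1 + D2)
    Bden := (E.map fun u => (dist1 p u, D2)) ++ (E.map fun u => (dist1 r u, D1)) }

/-- Indices of the terms of `P` that are POSITIVE under the pattern. [folklore] -/
def posTerms (ord : List Atom) (s : Bool) (P : List Term) : List ℕ :=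
  (List.range P.length).filter fun n => match P[n]? with
    | some T => !termNeg ord s T
    | none => false

/-- The single-positive-term row `|tₙ| ≤ t_p`: `∏ x^{Aₙ} · |γₙ| ≤ ∏ x^{A_p} · |γ_p|`. [folklore] -/
def rowOne (ord : List Atom) (P : List Term) (p n : ℕ) : Row :=
  let Tp := P.getD p (0, [])
  let Tn := P.getD n (0, [])
  { L := posl ord Tn.2, R := posl ord Tp.2, Bnum := [(Tp.1.natAbs, 1)], Bden := [(Tn.1.natAbs, 1)] }

/-- The AM–GM row over the negative terms `S` (`m = |S|`): `m^m ∏_{j∈S} |γⱼ| ∏ x^{Aⱼ} ≤ |γ_p|^m (∏ x^{A_p})^m`. [folklore] -/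
def rowAmgm (ord : List Atom) (P : List Term) (p : ℕ) (S : List ℕ) : Row :=
  let Tp := P.getD p (0, [])
  let m := S.length
  { L := (S.map fun j => posl ord (P.getD j (0, [])).2).flatten
    R := (List.replicate m (posl ord Tp.2)).flatten
    Bnum := [(Tp.1.natAbs, m)]
    Bden := (m, m) :: S.map fun j => ((P.getD j (0, [])).1.natAbs, 1) }

/-- Row specifications a certificate may use. [folklore] -/
inductive RowSpec where
  /-- Newton-cone row through position `t` -/
  | c25 (t : ℕ)
  /-- `|tₙ| ≤ t₊` from the single-positive inequality `P` -/
  | one (P : PolySpec) (n : ℕ)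
  /-- AM–GM over the negative terms `S` of the single-positive inequality `P` -/
  | amgm (P : PolySpec) (S : List ℕ)

/-- Side condition of a named inequality under the pattern: `RCS` needs a definite first letter. [folklore] -/
def PolySpec.defOK (ord : List Atom) (s : Bool) : PolySpec → Bool
  | .rcs i _ => !negAt s (posOf (qA i) ord)
  | _ => true

/-- Validity of an inequality for row extraction: indices valid, `RCS` only with a definite first letter,
exactly one positive term; returns the index of the positive term. [folklore] -/
def posIndex (ord : List Atom) (s : Bool) (P : PolySpec) : Option ℕ :=
  if P.valid && P.defOK ord s then
    match posTerms ord s P.poly with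
    | [p] => some p
    | _ => none
  else none

/-- Build a row from its specification, checking its side conditions. [folklore] -/
def buildRow (d : List ℕ) (ord : List Atom) (s : Bool) : RowSpec → Option Row
  | .c25 t => if 1 ≤ t ∧ t ≤ 19 then some (rowC25 (sums d ord) t) else none
  | .one P n =>
    match posIndex ord s P with
    | some p => if n < P.poly.length ∧ n ≠ p then some (rowOne ord P.poly p n) else none
    | none => none
  | .amgm P S =>
    match posIndex ord s P with
    | some p =>
      if decide (∀ j ∈ S, j < P.poly.length ∧ j ≠ p) && decide S.Nodup && decide (S ≠ [] ∧ S.length ≤ 4) then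
        some (rowAmgm ord P.poly p S) else none
    | none => none

/-! ## Exponent balance and the constant comparison -/
/-- Add `n` to entry `p` of a count vector. [folklore] -/
def bump : List ℕ → ℕ → ℕ → List ℕ
  | [], _, _ => []
  | v :: vs, 0, n => (v + n) :: vs
  | v :: vs, p + 1, n => v :: bump vs p n

/-- Add `n` at every position of `ps`. [folklore] -/
def bumps (v : List ℕ) (ps : List ℕ) (n : ℕ) : List ℕ := ps.foldl (fun w p => bump w p n) v

/-- The zero count vector over the 21 positions. [folklore] -/
def zero21 : List ℕ := List.replicate 21 0

/-- A rational in factored form `∏ b^z`, `z ∈ ℤ`, as a list of `(b, z)`. [folklore] -/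
abbrev FRat := List (ℕ × ℤ)

/-- Multiply a factored rational by `b^z`, merging with an existing base `b`. [folklore] -/
def insZ : FRat → ℕ → ℤ → FRat
  | [], b, z => [(b, z)]
  | (b', z') :: A, b, z => if b' = b then (b, z' + z) :: A else (b', z') :: insZ A b z

/-- Multiply by `(val F)^n`. [folklore] -/
def mulF (A : FRat) (F : FNat) (n : ℕ) : FRat := F.foldl (fun B be => insZ B be.1 ((be.2 * n : ℕ) : ℤ)) A

/-- Divide by `(val F)^n`. [folklore] -/
def divF (A : FRat) (F : FNat) (n : ℕ) : FRat := F.foldl (fun B be => insZ B be.1 (-((be.2 * n : ℕ) : ℤ))) A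

/-- Numerator of a factored rational after cancellation: `∏_{z > 0} b^z`. [folklore] -/
def numZ (A : FRat) : ℕ := (A.map fun bz => if 0 < bz.2 then bz.1 ^ bz.2.toNat else 1).prod

/-- Denominator of a factored rational after cancellation: `∏_{z < 0} b^{−z}`. [folklore] -/
def denZ (A : FRat) : ℕ := (A.map fun bz => if bz.2 < 0 then bz.1 ^ (-bz.2).toNat else 1).prod

/-- Accumulated Farkas product of rows with natural multipliers: count vectors of both sides and the factored
ratio `∏ Bden^N / ∏ Bnum^N`. [folklore] -/
def accumulate (rows : List (Row × ℕ)) : List ℕ × List ℕ × FRat :=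
  rows.foldl (fun acc rn =>
      (bumps acc.1 rn.1.L rn.2, bumps acc.2.1 rn.1.R rn.2, divF (mulF acc.2.2 rn.1.Bden rn.2) rn.1.Bnum rn.2))
    (zero21, zero21, [])

/-- Build all rows of a list of specifications (with multipliers); `none` if one is invalid. [folklore] -/
def buildRows (d : List ℕ) (ord : List Atom) (s : Bool) : List (RowSpec × ℕ) → Option (List (Row × ℕ))
  | [] => some []
  | (rs, n) :: rest =>
    match buildRow d ord s rs, buildRows d ord s rest with
    | some r, some rr => some ((r, n) :: rr)
    | _, _ => none

/-! ## Certificates -/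

/-- A competitor of a domination certificate: the positive term `k`, its bounding rows, the root degree `D`,
and the numerator `un` of its bound `u_k = un / ud`. [folklore] -/
structure Comp where
  /-- index of the positive term -/
  k : ℕ
  /-- rows with multipliers -/
  rows : List (RowSpec × ℕ)
  /-- root degree -/
  D : ℕ
  /-- numerator of the bound -/
  un : ℕ

/-- Certificates that a cell `(d, s)` carries no twenty. [folklore] -/
inductive Cert where
  /-- odd definite triangle through letters `i, j, k` -/
  | sign (i j k : ℕ)
  /-- Farkas combination of rows -/
  | lp (rows : List (RowSpec × ℕ))
  /-- single-monomial domination of `P ≥ 0`: negative term `n0`, common denominator `ud`, competitors -/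
  | dom (P : PolySpec) (n0 : ℕ) (ud : ℕ) (comps : List Comp)

/-- Check an LP (Farkas) certificate: balance of exponents and `∏ Bden^N > ∏ Bnum^N`. [folklore] -/
def lpOK (d : List ℕ) (ord : List Atom) (s : Bool) (rows : List (RowSpec × ℕ)) : Bool :=
  match buildRows d ord s rows with
  | none => false
  | some rs =>
    let acc := accumulate rs
    decide (acc.1 = acc.2.1) && decide (denZ acc.2.2 < numZ acc.2.2)

/-- Check one competitor of a domination certificate. [folklore] -/
def compOK (d : List ℕ) (ord : List Atom) (s : Bool) (P : List Term) (n0 ud : ℕ) (c : Comp) : Bool :=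
  match buildRows d ord s c.rows with
  | none => false
  | some rs =>
    let acc := accumulate rs
    let T0 := P.getD n0 (0, [])
    let Tk := P.getD c.k (0, [])
    let A := divF (mulF acc.2.2 [(c.un * T0.1.natAbs, c.D)] 1) [(Tk.1.natAbs * ud, c.D)] 1
    decide (0 < c.D) && decide (0 < c.un) &&
      decide (bumps acc.1 (posl ord T0.2) c.D = bumps acc.2.1 (posl ord Tk.2) c.D) &&
      decide (denZ A ≤ numZ A)

/-- Check a domination certificate. [folklore] -/
def domOK (d : List ℕ) (ord : List Atom) (s : Bool) (P : PolySpec) (n0 ud : ℕ) (comps : List Comp) : Bool :=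
  let poly := P.poly
  let pos := posTerms ord s poly
  P.valid && P.defOK ord s && decide (n0 < poly.length) && termNeg ord s (poly.getD n0 (0, [])) && decide (0 < ud) &&
    decide (∀ k ∈ pos, ∃ c ∈ comps, c.k = k) && decide (∀ c ∈ comps, c.k ∈ pos) &&
    decide ((comps.map Comp.k).Nodup) &&
    decide ((comps.map Comp.un).sum < ud) &&
    comps.all (compOK d ord s poly n0 ud)

/-- Check an odd definite triangle. [folklore] -/
def signOK (ord : List Atom) (s : Bool) (i j k : ℕ) : Bool :=
  decide (i < j ∧ j < k ∧ k < 6) &&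
    !negAt s (posOf (qA i) ord) && !negAt s (posOf (qA j) ord) && !negAt s (posOf (qA k) ord) &&
    oddTrues [negAt s (posOf (cA i j) ord), negAt s (posOf (cA j k) ord), negAt s (posOf (cA i k) ord)]

/-- Check a certificate for the cell `(d, s)` against a verified order. [folklore] -/
def certOK (d : List ℕ) (ord : List Atom) (s : Bool) : Cert → Bool
  | .sign i j k => signOK ord s i j k
  | .lp rows => lpOK d ord s rows
  | .dom P n0 ud comps => domOK d ord s P n0 ud comps

/-- Check a cell: compute and verify the order, then the certificate. [folklore] -/
def checkCell (d : List ℕ) (s : Bool) (c : Cert) : Bool :=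
  let ord := sortAtoms d
  ordOK d ord && certOK d ord s c

/-- A table line: a support with one certificate per orientation. [folklore] -/
abbrev Line := List ℕ × Cert × Cert

/-- Check a table against its key list: keys match and every line passes in both orientations. [folklore] -/
def tableOK (keys : List (List ℕ)) (T : List Line) : Bool :=
  decide (T.map (fun l => l.1) = keys) && T.all fun l => checkCell l.1 true l.2.1 && checkCell l.1 false l.2.2

/-! ## The box: sorted supports `0 = d₀ < ⋯ < d₅`, Sidon test, mirror, cover by slices `(d₅, d₄-range)` -/

/-- All increasing lists of length `n` with entries in `[low, hi]`. [folklore] -/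
def incLists : ℕ → ℕ → ℕ → List (List ℕ)
  | 0, _, _ => [[]]
  | n + 1, low, hi => (List.range' low (hi + 1 - low)).flatMap fun a => (incLists n (a + 1) hi).map fun l => a :: l

/-- The 21 pair sums of a six-element list, spelled out (cheap for the kernel). [folklore] -/
def psums6 : List ℕ → List ℕ
  | [a0, a1, a2, a3, a4, a5] =>
    [a0 + a0, a0 + a1, a0 + a2, a0 + a3, a0 + a4, a0 + a5, a1 + a1, a1 + a2, a1 + a3, a1 + a4, a1 + a5, a2 + a2,
      a2 + a3, a2 + a4, a2 + a5, a3 + a3, a3 + a4, a3 + a5, a4 + a4, a4 + a5, a5 + a5]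
  | _ => []

/-- No entry of the list equals `a`. [folklore] -/
def freshIn (a : ℕ) : List ℕ → Bool
  | [] => true
  | b :: l => !(Nat.beq b a) && freshIn a l

/-- All entries distinct (a Boolean `Nodup` with bare `Nat.beq`). [folklore] -/
def distinctB : List ℕ → Bool
  | [] => true
  | a :: l => freshIn a l && distinctB l

/-- Are the 21 pair sums of a six-element support pairwise distinct (2-Sidon)? [folklore] -/
def sidon (d : List ℕ) : Bool := distinctB (psums6 d)

/-- The mirror support `d₅ − d₅, d₅ − d₄, …, d₅ − d₀`. [folklore] -/
def mirror (d : List ℕ) : List ℕ := (d.map fun x => d.getD 5 0 - x).reverse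

/-- The keys with top exponent `f`. [folklore] -/
def keysTop (keys : List (List ℕ)) (f : ℕ) : List (List ℕ) := keys.filter fun k => k.getD 5 0 == f

/-- Cover check of one support `[0] ++ l ++ [e, f]` against the key buckets `kd` (direct) and `km` (mirror). [folklore] -/
def coverCell (kd km : List (List ℕ)) (f e : ℕ) (l : List ℕ) : Bool :=
  !sidon (0 :: (l ++ [e, f])) || kd.contains (0 :: (l ++ [e, f])) || km.contains (mirror (0 :: (l ++ [e, f])))

/-- Cover check of the supports with `d₄ = e`, `d₅ = f` (buckets: keys with `d₄ = e`, resp. `d₁ = f − e`). [folklore] -/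
def coverRow (keys : List (List ℕ)) (f e : ℕ) : Bool :=
  (incLists 3 1 (e - 1)).all
    (coverCell ((keysTop keys f).filter fun k => k.getD 4 0 == e) ((keysTop keys f).filter fun k => k.getD 1 0 == f - e) f e)

/-- Cover check of one slice `(f, elo, ehi)`: all supports with `d₅ = f`, `elo ≤ d₄ ≤ ehi`. [folklore] -/
def coverSlice (keys : List (List ℕ)) (s : ℕ × ℕ × ℕ) : Bool :=
  (List.range' s.2.1 (s.2.2 + 1 - s.2.1)).all fun e => coverRow keys s.1 e

/-- Cover check of a list of slices. [folklore] -/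
def coverSlices (keys : List (List ℕ)) (L : List (ℕ × ℕ × ℕ)) : Bool := L.all (coverSlice keys)

/-- A slice plan exhausts the box `d₅ ≤ N`: every `(f, e)` with `4 ≤ e < f ≤ N` lies in a slice `(f, elo, ehi)`. [folklore] -/
def planCovers (N : ℕ) (P : List (ℕ × ℕ × ℕ)) : Bool :=
  (List.range (N + 1)).all fun f => (List.range f).all fun e =>
    !(Nat.ble 4 e) || P.any fun s => (s.1 == f) && Nat.ble s.2.1 e && Nat.ble e s.2.2

end Summit.ValiantsHypothesis.ValiantsHypothesis.Theorems.LacunarySymmetroidMatrixDescartes.Census.V20
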